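import Summits.ABC.IUTFork.Repair.RHHullCellSlice
import HarnessLib

/-!
# R-H ROUND 3 (C-ii) SLACK-LAW: the exact U2 cell's DEFICIT above the slice boundary is a QUADRATIC RAMP — never a cliff —
# and its floor-free credit fraction is ANTITONE in the label

abc-iut cell, rung LADDER-ABC:A2.RESCUE.H; seat abc-iut-rh2-tab-2 (Q1′ numerics, HEX lane, gen 3) taking the unowned «SLACK-LAW kernel
companion» of the human's 2026-08-27T00:58:14Z question (C)(ii) «per-cell slack vs label j above j₀(w) — cliff or gradual?» (rh-lead
01:15:17Z «GO rh-typ-3 SLACK-LAW stands for the kernel companion»; numerics of record: rh-kit-2 PASS 20 PROFILE; K-line block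
`HOME/abc-iut-rh2-tab-2/SLACK-PROFILE-HEX-v1.*`, law sentence SIGNED by abc-iut-rh3-ref-1 01:23:49Z). PROOF-ONLY file (0 definitions,
0 `Prop` facts): integer identities and inequalities about the typed cell
`RH.DiffPricedHull.HullCellδ e m j δ r_in r_out :⟺ e·⌊(j²m − jδ − (j+1)r_in)/e⌋ ≤ m − (j+1)·r_out` (the R-W WINDOW-TABLE exact U2 cell,
MIN-SLICE §(i-w2).1), over abc-iut-rh2-w-2's `RHHullCellSlice` (p-landed: ledger form `hullCellδ_iff_demand_le_price`, `gain_bounds`,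
`linear_lt_of_not_hullCellδ`, downward closure) — cited BY NAME, nothing restated.

NOTATION (spelled out in every statement, no `def`): DEMAND `d_j := (j²−1)·m` (the cell's trivial cost in w-units), log-shell span
`G := r_in − r_out`, integral-structure gain `ρ_j := (j²m − jδ − (j+1)r_in) mod e ∈ [0, e−1]`, PRICE `price_j := j·δ + (j+1)·G + ρ_j`,
exact DEFICIT `def_j := d_j − price_j` (= `−margin_U2cell(w,j)`; the data cost of MIN-SLICE §(i) is `c_p·def_j⁺`), FLOOR-FREE deficit
`D(j) := m·j² − (δ+G)·j − (m+G)` (so `def_j = D(j) − ρ_j`).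

WHAT IS PROVED (namespace `Summit.ABC.IUTFork.Repair.RH.HullCellSlackLaw`):
* §1 `demand_sub_price_eq`: `def_j = m·j² − (δ+G)·j − (m+G) − ρ_j` — the law abc-iut-rh3-ref-1 re-derived symbolically and rh-kit-2 PASS 20
  pre-registered as its identity flag (tab-2: 0 violations on 4,162,120 HEX cells); `margin_eq_price_sub_demand` (the table's margin IS
  `price − demand`); `not_hullCellδ_iff_deficit_pos` (a label is OFF iff its deficit is positive); `deficit_bracket` (`D(j) − (e−1) ≤ def_j ≤ D(j)`).
* §2 «QUADRATIC, NEVER A CLIFF»: `floorFree_deficit_succ_sub` (first difference `D(j+1) − D(j) = (2j+1)·m − (δ+G)`, LINEAR in `j`) and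
  `floorFree_deficit_second_diff` (second difference `= 2m`, constant); `succ_sub_ge_of_not_hullCellδ`: at a FAILING label `j ≥ 1` the step is
  `≥ e − 1 ≥ 0` (w-2's key inequality `δ + G + (e−1) ≤ (2j+1)·m`), whence `deficit_succ_ge_of_not_hullCellδ` / `deficit_mono_of_not_hullCellδ`:
  the EXACT deficit is non-decreasing from the first failing label on (the ramp only steepens: slope `(2j+1)m − (δ+G)`, curvature `2m`).
* §3 «HYPERBOLIC CREDIT»: `price_succ_mul_demand_le` — for `δ ≥ 0`, `G ≥ 0`, `m ≥ 0`, `j ≥ 1` the floor-free credit fraction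
  `((δ+G)j + G)/((j²−1)m)` is ANTITONE in `j` (cross-multiplied; identity `RHS − LHS = m·((δ+G)j² + (δ+3G)j + (δ+2G))`): the kernel form of the
  signed sentence «c_j = j⋆/j decreasing above the boundary»; a per-label credit that stays linear in `j` cannot follow the quadratic demand.
* §3b `two_mul_sum_floorFree_price`: `2·Σ_{i<n}((δ+G)(J+1+i) + G) = n·((δ+G)(2J+n+1) + 2G)` — the full-price partial credit above the
  boundary in closed form (⇒ the signed law «π₄ = (3/2)·f·(1 − f²)» with `J = f·l⋇`, `(δ+G)/m ≈ J`).
* §4 sanity row by `decide`: HEX `λ₈ @ l = 11`, `p = 7` (`e = 165`, `m = 120`, `δ = 164`, `r_in = 28`, `r_out = −281`): deficits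
  `−847, −963, −914, −535, +174` at `j = 1…5` (MIN-SLICE §(i-w2).2 (a) margins with the sign flipped; `ρ_5 = 32`, price `2706`, demand `2880`).
HONEST FRAMING: integer arithmetic about OUR typed cell; whether a «partial credit» above the boundary can be banked in the volume
computation is a question for a candidate object, not asserted here; nothing here asserts that abc is proved or refuted, or that
[IUTchIII] Cor. 3.12 holds or fails at any datum, or takes a side on any author; typed ≠ proved; computed ≠ proved.
[claim: Mochizuki2012, status: disputed] for every IUT locution. [cite: Mochizuki2012, IUTchIV Prop. 1.4 p. 13; IUTchIII Cor. 3.12 p. 173]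
-/

namespace Summit.ABC.IUTFork.Repair.RH.HullCellSlackLaw

open Summit.ABC.IUTFork.Repair.RH.DiffPricedHull
open Summit.ABC.IUTFork.Repair.RH.HullCellSlice

/-! ## §1. The deficit identity (the SLACK LAW) -/

/-- **SLACK LAW (identity).** The exact deficit `d_j − price_j` of the U2 cell equals `m·j² − (δ + G)·j − (m + G) − ρ_j` with
`G = r_in − r_out` and `ρ_j = (j²m − jδ − (j+1)r_in) mod e`: a QUADRATIC in the label with leading coefficient `m = m_q` minus a bounded
residue — rh3-ref-1's symbolic re-derivation / rh-kit-2 PASS 20's identity flag / tab-2's 0-violation check, as a `ring` identity. [folklore] -/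
theorem demand_sub_price_eq (e m j δ rin rout : ℤ) :
    (j ^ 2 - 1) * m - (j * δ + (j + 1) * (rin - rout) + (j ^ 2 * m - j * δ - (j + 1) * rin) % e)
      = m * j ^ 2 - (δ + (rin - rout)) * j - (m + (rin - rout)) - (j ^ 2 * m - j * δ - (j + 1) * rin) % e := by
  ring

/-- **The table's margin IS `price − demand`**: `m − (e·⌊A_j/e⌋ + (j+1)·r_out) = price_j − d_j` with `A_j = j²m − jδ − (j+1)r_in`
(`e·⌊A/e⌋ = A − A mod e` for every `e`) — MIN-SLICE §(i-w2).1 «margin_j = price_j − d_j» for the R-W column `margin_U2cell`. [folklore] -/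
theorem margin_eq_price_sub_demand (e m j δ rin rout : ℤ) :
    m - (e * ((j ^ 2 * m - j * δ - (j + 1) * rin) / e) + (j + 1) * rout)
      = (j * δ + (j + 1) * (rin - rout) + (j ^ 2 * m - j * δ - (j + 1) * rin) % e) - (j ^ 2 - 1) * m := by
  have h1 := Int.mul_ediv_add_emod (j ^ 2 * m - j * δ - (j + 1) * rin) e
  linarith

/-- **A label is OFF iff its deficit is positive**: `¬ HullCellδ ⟺ 0 < d_j − price_j`. [folklore] -/
theorem not_hullCellδ_iff_deficit_pos (e m j δ rin rout : ℤ) :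
    ¬ HullCellδ e m j δ rin rout ↔
      0 < (j ^ 2 - 1) * m - (j * δ + (j + 1) * (rin - rout) + (j ^ 2 * m - j * δ - (j + 1) * rin) % e) := by
  rw [hullCellδ_iff_demand_le_price]
  constructor
  · intro h; push Not at h; linarith
  · intro h hle; linarith

/-- **Floor bracket for the deficit**: `D(j) − (e − 1) ≤ def_j ≤ D(j)` with the floor-free deficit `D(j) = m·j² − (δ+G)·j − (m+G)`
(`0 < e`; `ρ_j ∈ [0, e−1]` by `gain_bounds`). [folklore] -/
theorem deficit_bracket {e : ℤ} (he : 0 < e) (m j δ rin rout : ℤ) :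
    m * j ^ 2 - (δ + (rin - rout)) * j - (m + (rin - rout)) - (e - 1)
        ≤ (j ^ 2 - 1) * m - (j * δ + (j + 1) * (rin - rout) + (j ^ 2 * m - j * δ - (j + 1) * rin) % e) ∧
      (j ^ 2 - 1) * m - (j * δ + (j + 1) * (rin - rout) + (j ^ 2 * m - j * δ - (j + 1) * rin) % e)
        ≤ m * j ^ 2 - (δ + (rin - rout)) * j - (m + (rin - rout)) := by
  obtain ⟨h0, h1⟩ := gain_bounds he m j δ rin
  constructor <;> nlinarith [h0, h1]

/-! ## §2. Quadratic ramp, never a cliff -/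

/-- **First difference of the floor-free deficit**: `D(j+1) − D(j) = (2j+1)·m − (δ + G)` — LINEAR in the label (so «def_j ≈ a·(j − j₀) + b»
with constant `a` FAILS wherever more than a couple of labels lie above the boundary). [folklore] -/
theorem floorFree_deficit_succ_sub (m j δ G : ℤ) :
    (m * (j + 1) ^ 2 - (δ + G) * (j + 1) - (m + G)) - (m * j ^ 2 - (δ + G) * j - (m + G)) = (2 * j + 1) * m - (δ + G) := by
  ring

/-- **Second difference of the floor-free deficit is the constant `2m`**: class «QUADRATIC» at every place with `m = m_q > 0`
(rh-kit-2 PASS 20 column «Δ² vs 2m_q»; the exact deficit's second difference is `2m` up to the residue jitter `|Δ²ρ| ≤ 2(e−1)`). [folklore] -/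
theorem floorFree_deficit_second_diff (m j δ G : ℤ) :
    (m * (j + 2) ^ 2 - (δ + G) * (j + 2) - (m + G)) - 2 * (m * (j + 1) ^ 2 - (δ + G) * (j + 1) - (m + G))
        + (m * j ^ 2 - (δ + G) * j - (m + G)) = 2 * m := by
  ring

/-- **At a FAILING label the ramp already climbs by at least `e − 1` per label**: if `¬ HullCellδ` at `j ≥ 1` then
`e − 1 ≤ (2j+1)·m − (δ + G)` (`0 < e`, `e − 1 ≤ δ`, `r_out ≤ r_in`, `0 ≤ m`) — abc-iut-rh2-w-2's key inequality
`δ + G + (e−1) ≤ (2j+1)·m` (proof of `not_hullCellδ_succ_of_not_hullCellδ`), isolated for citation: from `linear_lt_of_not_hullCellδ`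
(`jδ + (j+1)G ≤ (j²−1)m − 1`) one gets `j·(δ + G + e − 1) ≤ j·(2δ + G) ≤ 2(jδ + (j+1)G) ≤ 2(j²−1)m − 2 ≤ j·(2j+1)·m`. [folklore] -/
theorem succ_sub_ge_of_not_hullCellδ {e m j δ rin rout : ℤ} (he : 0 < e) (hδ : e - 1 ≤ δ) (hio : rout ≤ rin) (hm : 0 ≤ m)
    (hj : 1 ≤ j) (h : ¬ HullCellδ e m j δ rin rout) :
    e - 1 ≤ (2 * j + 1) * m - (δ + (rin - rout)) := by
  have hlin := linear_lt_of_not_hullCellδ he h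
  have h1 : j * (δ + (rin - rout) + (e - 1)) ≤ j * ((2 * j + 1) * m) := by
    have hX : 0 ≤ rin - rout := by omega
    nlinarith
  have h2 := le_of_mul_le_mul_left h1 (by omega)
  linarith

/-- **The EXACT deficit does not decrease past a failing label**: if `¬ HullCellδ` at `j ≥ 1` then `def_j ≤ def_{j+1}`
(`def_{j+1} − def_j = [(2j+1)m − (δ+G)] − (ρ_{j+1} − ρ_j) ≥ (e−1) − (e−1) = 0`). [folklore] -/
theorem deficit_succ_ge_of_not_hullCellδ {e m j δ rin rout : ℤ} (he : 0 < e) (hδ : e - 1 ≤ δ) (hio : rout ≤ rin) (hm : 0 ≤ m)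
    (hj : 1 ≤ j) (h : ¬ HullCellδ e m j δ rin rout) :
    (j ^ 2 - 1) * m - (j * δ + (j + 1) * (rin - rout) + (j ^ 2 * m - j * δ - (j + 1) * rin) % e)
      ≤ ((j + 1) ^ 2 - 1) * m
          - ((j + 1) * δ + (j + 1 + 1) * (rin - rout) + ((j + 1) ^ 2 * m - (j + 1) * δ - (j + 1 + 1) * rin) % e) := by
  have hstep := succ_sub_ge_of_not_hullCellδ he hδ hio hm hj h
  obtain ⟨h0, _⟩ := gain_bounds he m j δ rin
  obtain ⟨_, h1'⟩ := gain_bounds he m (j + 1) δ rin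
  nlinarith [h0, h1', hstep]

/-- **Monotone ramp**: if `¬ HullCellδ` at `j ≥ 1` then for every `j' ≥ j` the exact deficit at `j'` is at least the one at `j`
(induction on `j' − j` with `not_hullCellδ_mono`: every label above a failing one fails). In words: above the slice boundary the data cost
per cell only GROWS with the label — gradual onset (`def_{j₀+1} ≤ (2j₀+1)m − (δ+G) + …`), quadratic growth, no cliff and no recovery. [folklore] -/
theorem deficit_mono_of_not_hullCellδ {e m j j' δ rin rout : ℤ} (he : 0 < e) (hδ : e - 1 ≤ δ) (hio : rout ≤ rin) (hm : 0 ≤ m)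
    (hj : 1 ≤ j) (hjj : j ≤ j') (h : ¬ HullCellδ e m j δ rin rout) :
    (j ^ 2 - 1) * m - (j * δ + (j + 1) * (rin - rout) + (j ^ 2 * m - j * δ - (j + 1) * rin) % e)
      ≤ (j' ^ 2 - 1) * m - (j' * δ + (j' + 1) * (rin - rout) + (j' ^ 2 * m - j' * δ - (j' + 1) * rin) % e) := by
  obtain ⟨n, rfl⟩ : ∃ n : ℕ, j' = j + n := ⟨(j' - j).toNat, by omega⟩
  induction n with
  | zero => simp
  | succ n ih =>
    have hfail : ¬ HullCellδ e m (j + (n : ℤ)) δ rin rout := not_hullCellδ_mono he hδ hio hm hj (by omega) h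
    have hs := deficit_succ_ge_of_not_hullCellδ he hδ hio hm (by omega) hfail
    have h1 : j + ((n : ℤ) + 1) = j + (n : ℤ) + 1 := by ring
    push_cast
    rw [h1]
    exact le_trans (ih (by omega)) hs

/-! ## §3. Hyperbolic credit: the floor-free credit fraction is antitone -/

/-- **CREDIT FRACTION ANTITONE (floor-free).** With `G = r_in − r_out ≥ 0`, `δ ≥ 0`, `m ≥ 0`, `j ≥ 1`:
`((δ+G)(j+1) + G)·((j²−1)·m) ≤ ((δ+G)j + G)·(((j+1)²−1)·m)`, i.e. `price_{j+1}/d_{j+1} ≤ price_j/d_j` for the floor-free price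
`(δ+G)·j + G` (cross-multiplied; the difference is `m·((δ+G)j² + (δ+3G)j + (δ+2G)) ≥ 0`). This is the kernel form of the signed (C-ii)
sentence «above the boundary the remaining credit fraction c_j = j⋆/j DECREASES hyperbolically — no cliff»: a price LINEAR in the label against a
demand QUADRATIC in the label. [folklore] -/
theorem price_succ_mul_demand_le {m j δ G : ℤ} (hm : 0 ≤ m) (hδ : 0 ≤ δ) (hG : 0 ≤ G) (hj : 1 ≤ j) :
    ((δ + G) * (j + 1) + G) * ((j ^ 2 - 1) * m) ≤ ((δ + G) * j + G) * (((j + 1) ^ 2 - 1) * m) := by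
  have hid : ((δ + G) * j + G) * (((j + 1) ^ 2 - 1) * m) - ((δ + G) * (j + 1) + G) * ((j ^ 2 - 1) * m)
      = m * ((δ + G) * j ^ 2 + (δ + 3 * G) * j + (δ + 2 * G)) := by ring
  have hpos : 0 ≤ m * ((δ + G) * j ^ 2 + (δ + 3 * G) * j + (δ + 2 * G)) := by
    apply mul_nonneg hm
    nlinarith
  linarith

/-- The same at the cell's parameters (`0 < e`, `e − 1 ≤ δ`, `r_out ≤ r_in`, `0 ≤ m`, `1 ≤ j`), `G := r_in − r_out`. [folklore] -/
theorem price_succ_mul_demand_le_cell {e m j δ rin rout : ℤ} (he : 0 < e) (hδ : e - 1 ≤ δ) (hio : rout ≤ rin) (hm : 0 ≤ m)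
    (hj : 1 ≤ j) :
    ((δ + (rin - rout)) * (j + 1) + (rin - rout)) * ((j ^ 2 - 1) * m)
      ≤ ((δ + (rin - rout)) * j + (rin - rout)) * (((j + 1) ^ 2 - 1) * m) :=
  price_succ_mul_demand_le hm (by omega) (by omega) hj

/-! ## §3b. Closed form of the floor-free partial credit above the boundary -/

/-- **Sum of the floor-free price over the `n` labels `J+1, …, J+n`** (doubled to stay in `ℤ`):
`2·Σ_{i<n} ((δ+G)·(J+1+i) + G) = n·((δ+G)·(2J + n + 1) + 2G)` — so a FULL-PRICE partial-credit object banks, above the boundary `J` and up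
to `l⋇ = J + n`, the amount `(δ+G)·(l⋇(l⋇+1) − J(J+1))/2 + G·(l⋇ − J)` (up to the residues `Σρ_j ∈ [0, n(e−1)]`), i.e. `≈ (δ+G)·(l⋇² − J²)/2`
against the total demand `≈ m·l⋇³/3`: with `J ≈ (δ+G)/m = f·l⋇` this is the signed law «π₄ = (3/2)·f·(1 − f²)» of SLACK-PROFILE-HEX-v1.
(Induction on `n`.) [folklore] -/
theorem two_mul_sum_floorFree_price (δ G J : ℤ) (n : ℕ) :
    2 * (∑ i ∈ Finset.range n, ((δ + G) * (J + 1 + (i : ℤ)) + G)) = (n : ℤ) * ((δ + G) * (2 * J + (n : ℤ) + 1) + 2 * G) := by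
  induction n with
  | zero => simp
  | succ n ih =>
    rw [Finset.sum_range_succ, mul_add, ih]
    push_cast
    ring

/-! ## §4. Sanity row (MIN-SLICE §(i-w2).2 (a): HEX `λ₈ @ l = 11`, `p = 7`) -/

/-- HEX `λ₈ @ l = 11`, `p = 7`: `e = 165`, `m = 120`, `δ = 164`, `r_in = 28`, `r_out = −281`; the exact deficits `d_j − price_j` at
`j = 1, …, 5` are `−847, −963, −914, −535, 174` (the R-W margins `847 963 914 535 −174` with the sign flipped; at `j = 5`: demand `2880`,
`ρ_5 = 32`, price `2706`) and the boundary is `J = 4` (`RHHullCellSlice.rows_worked_example`). [folklore] -/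
theorem row_hex8_l11 :
    ((1 : ℤ) ^ 2 - 1) * 120 - (1 * 164 + (1 + 1) * (28 - (-281)) + ((1 : ℤ) ^ 2 * 120 - 1 * 164 - (1 + 1) * 28) % 165) = -847 ∧
    ((2 : ℤ) ^ 2 - 1) * 120 - (2 * 164 + (2 + 1) * (28 - (-281)) + ((2 : ℤ) ^ 2 * 120 - 2 * 164 - (2 + 1) * 28) % 165) = -963 ∧
    ((3 : ℤ) ^ 2 - 1) * 120 - (3 * 164 + (3 + 1) * (28 - (-281)) + ((3 : ℤ) ^ 2 * 120 - 3 * 164 - (3 + 1) * 28) % 165) = -914 ∧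
    ((4 : ℤ) ^ 2 - 1) * 120 - (4 * 164 + (4 + 1) * (28 - (-281)) + ((4 : ℤ) ^ 2 * 120 - 4 * 164 - (4 + 1) * 28) % 165) = -535 ∧
    ((5 : ℤ) ^ 2 - 1) * 120 - (5 * 164 + (5 + 1) * (28 - (-281)) + ((5 : ℤ) ^ 2 * 120 - 5 * 164 - (5 + 1) * 28) % 165) = 174 := by
  decide

end Summit.ABC.IUTFork.Repair.RH.HullCellSlackLaw
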